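import Summits.HodgeConjecture.HodgeConjecture.Theses.PeriodsPolice
import Literature.AlgebraicGeometry.Motives.PeriodRealizationClassicalCore
import Literature.AlgebraicGeometry.HodgeTheory.ComplexConjugationHolds

/-!
# Line `pieces-split` — `PeriodsPolice.ClassicalBridge` (stmt-HodgeConjecture-14652) DERIVED from three typed pieces

Registered skeleton of the crux-strategist BC2-redirect decomposition (unit
`cstrat-stmt-HodgeConjecture-14652-r1`).  Three stubs, each the verbatim statement of a piece:

* `stub_classicalPeriodRealization` (P1, construction, twist-sensitive schemas):
  `∃ P : PeriodRealization ℚ̄, P.IsClassicalCore ∧ HodgeRiemannIIStatement P.B ∧ P.B.W.HasProdHyperplaneClasses`;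
* `stub_bettiHardLefschetz` (P2, universal): `∀ B : BettiHodgeData ℂ, B.W.HasHardLefschetz`;
* `stub_bettiHodgeRiemannI` (P3, universal under the Hodge pin):
  `∀ B : BettiHodgeData ℂ, B.IsClassicalHodge → HodgeRiemannIStatement B`;

and the kernel-checked composition `ClassicalBridge_of` concluding the crux BY NAME: the pin from the
core (`IsClassicalCore.isClassicalHodge`), HL / HR-I instantiated at `P.B`, and the bridge clause
PROVED (`PeriodRealization.IsClassicalCore.hodgeConjectureFor` + `HodgeTheory.nonempty_hodgeModel_holds`).
Card: `Lines/pieces-split.md`.  Birth skeletons of the pieces: `Lines/p1_birth.lean`,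
`Lines/p2_birth.lean`, `Lines/p3_birth.lean`.
-/

set_option linter.dupNamespace false

namespace Summit.HodgeConjecture.HodgeConjecture.Cruxes.ClassicalBridge.PiecesSplit

open Literature.AlgebraicGeometry.Motives Literature.AlgebraicGeometry.HodgeTheory
open Summit.HodgeConjecture.HodgeConjecture.Theses.PeriodsPolice

/-- **P1 (construction).** A classical-core period realization over `ℚ̄` — Betti cohomology of the
complex points as a Weil cohomology with its genuine Hodge structures (pin (i)/(i')) and cycle classes
supported on their cycles ((ii-a)), algebraic de Rham cohomology over `ℚ̄` with its Hodge filtration and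
Grothendieck's comparison — whose Betti–Hodge datum satisfies Hodge–Riemann II (Voisin I Thm. 6.32 (ii))
and has product hyperplane classes (Segre–Veronese).  [Grothendieck 1966 Thm 1'; Deligne 1982 §1;
Voisin I §6–7, §11; Kleiman 1968 §1.2] -/
theorem stub_classicalPeriodRealization :
    ∃ P : PeriodRealization (AlgebraicClosure ℚ), P.IsClassicalCore ∧ HodgeRiemannIIStatement P.B ∧
      P.B.W.HasProdHyperplaneClasses := by
  sorry

/-- **P2 (hard Lefschetz for every Betti–Hodge datum).** A `W`-hyperplane class `η = ι* cl(D)` of any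
`B : BettiHodgeData ℂ` is, through `B.iso`, a NONZERO rational multiple of the ample class `ι*h`
(`b₂(ℙᴺ(ℂ)) = 1`; `η ≠ 0` by `tr(ηⁿ) > 0`), and `B.iso` intertwines `W`'s Lefschetz iterates with the
singular ones (`iso_cup`); so Voisin I Thm. 6.25 (tree: `nonempty_hardLefschetzNFold_holds`, any
embedding) gives bijectivity.  [VoisinHodgeI2002 Thm. 6.25; Kleiman1968 §1.4] -/
theorem stub_bettiHardLefschetz : ∀ B : BettiHodgeData ℂ, B.W.HasHardLefschetz := by
  sorry

/-- **P3 (Hodge–Riemann I under the pin).** For a pinned datum, `x ∈ Fᵖ Hⁱ`, `y ∈ F^{i+1-p} Hⁱ` and a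
hyperplane class `η` (a Hodge class, in `F¹ H²`): `x ∪ y ∪ ηʳ ∈ F^{n+1} H^{2n}(X^an) = 0`, `i + r = n`,
so `Q(x, y) = tr(x ∪ y ∪ ηʳ) = 0`.  [VoisinHodgeI2002 Thm. 6.32 (i), Lemma 7.30] -/
theorem stub_bettiHodgeRiemannI :
    ∀ B : BettiHodgeData ℂ, B.IsClassicalHodge → HodgeRiemannIStatement B := by
  sorry

/-- **Composition (kernel-checked): the three pieces give the crux `ClassicalBridge` by name.**
The bridge clause of the crux is proved here, not assumed. -/
theorem ClassicalBridge_of :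
    (∃ P : PeriodRealization (AlgebraicClosure ℚ), P.IsClassicalCore ∧ HodgeRiemannIIStatement P.B ∧
        P.B.W.HasProdHyperplaneClasses) →
    (∀ B : BettiHodgeData ℂ, B.W.HasHardLefschetz) →
    (∀ B : BettiHodgeData ℂ, B.IsClassicalHodge → HodgeRiemannIStatement B) →
    Summit.HodgeConjecture.HodgeConjecture.Theses.PeriodsPolice.ClassicalBridge := by
  intro h₁ h₂ h₃
  obtain ⟨P, hcore, hII, hprod⟩ := h₁
  have hpin : P.B.IsClassicalHodge := hcore.isClassicalHodge
  refine ⟨P, hpin, ⟨h₃ P.B hpin, hII, h₂ P.B, hprod⟩, ?_⟩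
  intro σ n X₀ hX hHC
  exact hcore.hodgeConjectureFor σ hX (nonempty_hodgeModel_holds hX) hHC

/-- The crux from the three stubs (what a prover closing the stubs lands). -/
theorem classicalBridge : Summit.HodgeConjecture.HodgeConjecture.Theses.PeriodsPolice.ClassicalBridge :=
  ClassicalBridge_of stub_classicalPeriodRealization stub_bettiHardLefschetz stub_bettiHodgeRiemannI

end Summit.HodgeConjecture.HodgeConjecture.Cruxes.ClassicalBridge.PiecesSplit
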